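import Summits.ABC.IUTFork.Repair.ObstructionSS10
import Summits.ABC.IUTFork.Repair.CandJoshi9
import Summits.ABC.IUTFork.Repair.CandJoshi3
import HarnessLib

/-!
# IUT REPAIR branch (rung LADDER-ABC:A2.RP), rows RP-J01a/b/c + RP-J02a/b — PROFILE v0.4 cells on the bed SCAL (abc-iut-rp-s2's pinned setting
# over the SCALING shells, `ObstructionSS10`): ALL FIVE Joshi-shaped candidates HOLD there — including the Θ-side FILLING — and `−|log(Θ)| = +∞`

PROOF-ONLY record file (D-0012; no `Prop` fact; the only `def` is a toy packet-automorphism family, MODEL DATA) of the abc-iut cell, IUT REPAIR branch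
(seat abc-iut-rp-j1; the SCAL column of abc-iut-rp-plan's TASK RULINGS #24 (5) «… and SCAL (a pinned setting over the scaling shells if s3's/j2's lands
in time)» — rp-s2's `ObstructionSS10.sSetting` (p-id in rp-s2's lines) landed first and is used BY NAME). TAKES NO SIDE on [IUTchIII] Cor. 3.12 and on no
author; typed ≠ proved; instantiated ≠ endorsed. Candidates (reading predicates, never asserted): H_J1 `CandJoshi1.JoshiDominance`, H_J2
`CandJoshi1.JoshiVolumeDominance`, H_J2ᵖˡ `CandJoshi9.JoshiPlaceDominance`, H_J3 `CandJoshi3.LocusCovers`, H_J3′ `CandJoshi3.ShellFilling`.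

THE BED (cited by name): abc-iut-w4-d098's scaling shells `scalingShells p` (`Repair/ScalarShells`, p429955: Ism = ALL nonzero rational scalars) and
rp-s2's pinned setting `ObstructionSS10.sSetting p` over `sLattice p` (honest object side; ball frames on `𝔽_l^⋇`, the one-point frame `{0}` at the junk
label `0`; Θ-glue `B_{j²}`, q-glue `B_1`; X-reading operator `rho`, datum `qK`; two pins `door_b_pinnedRegions`, KummerB `door_b_kummerB`, and the
residual `S` through the rescaling `carrier` — `door_b_S`).

RESULTS (kernel, standard axioms):
* §1 `joshiVolumeDominance_of_reading3` (general, no bridge hypothesis): READING R3 ⟹ H_J2 (take the q-region itself as the dominating possible image).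
* §2 the ONE-FACTOR scaling family `oneFam u` (scalar `u ∈ ℚˣ` on factor `0` of every packet) is an (Ind2)-family of the scaling shells acting on each
  packet line by `u`, hence carrying `B_k ↦ B_{k + v_p(u)}`; with `u = p^{±1}` EVERY ball is a possible image of the Θ-pilot at every label of `𝔽_l^⋇`
  (`sBall_mem_possibleImages`).
* §3 THE CELLS at SCAL: **H_J1 ✓ H_J2 ✓ H_J2ᵖˡ ✓ H_J3 ✓ H_J3′ ✓** (`scal_joshiDominance`, `scal_joshiVolumeDominance`, `scal_placeDominance`,
  `scal_locusCovers`, **`scal_shellFilling`** — the FIRST model of record where Joshi's filling claim holds non-degenerately: every hull-set between a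
  Θ-image and the log-shell IS a possible image, because the indeterminacy group rescales), together with **the price** `scal_price`: `−|log(Θ)| = +∞`,
  ¬Statement, ¬BridgeHyps (this seat's `CandJoshi3.not_statement_of_unbounded_orbit`, instantiated by `oneFam p⁻¹`); packaged `scal_cells`.
READING (neutral, for PROFILE v0.4 / §J): the five columns read (H_J1, H_J2, H_J2ᵖˡ, H_J3, H_J3′) = P♮ ✓✓✓✓✗ · uSetting ✗✗✗✗✗ · uLinkId ✓✓✓✓✗
(`CandJoshi1Beds`, p432070) · **SCAL ✓✓✓✓✓ with S ✓ and Statement ✗ (first clause)**. The scaling bed is where Joshi's claims are realised IN FULL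
inside the frozen typing — and exactly there the inequality has no finite left-hand side. Which (Ind2) [IUTchIII] means is the dispute, untouched.
[claim: Joshi2024ATSIII, status: disputed] [claim: Joshi2021ATSII, status: disputed]
-/

noncomputable section

open Set

namespace Summit.ABC.IUTFork.Repair.CandJoshi1BedScal

open Thm311 Cor312 Cor312.Checks Cor312.IdentifiedNonVacuity Cor312Vol Literature.IUT.LogThetaLattice
open Cor312Vol.NaiveWitness Cor312Vol.UnitWitness Cor312Vol.PinnedWitness
open Summit.ABC.IUTFork.Repair.ScalarShells Summit.ABC.IUTFork.Repair.ObstructionSS10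
open Summit.ABC.IUTFork.Repair.CandJoshi1 Summit.ABC.IUTFork.Repair.CandJoshi3 Summit.ABC.IUTFork.Repair.CandJoshi9

/-! ## 1. READING R3 ⟹ H_J2 (general) -/

/-- **R3 ⟹ H_J2, on any setting, with no bridge hypothesis**: if the q-pilot's region is a possible image of the Θ-pilot in every packet of `𝔽_l^⋇`,
it is itself the dominating possible image (`qLocal` IS its log-volume). [folklore] -/
theorem joshiVolumeDominance_of_reading3 {T : ThetaIndex} {S₀ : Situation T} (P₀ : Cor312.Setting S₀)
    (h : ∀ (i : Fin T.lstar) (vQ : T.VQ), P₀.qRegion (Setting.labelSucc i) vQ ∈ P₀.possibleImages (Setting.labelSucc i) vQ) :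
    JoshiVolumeDominance P₀ := fun i vQ =>
  ⟨_, h i vQ, by unfold Setting.qLocal; exact le_rfl⟩

/-! ## 2. The one-factor scaling family of the scaling shells and the possible images of a ball -/

section Family

variable (p : ℕ) [hp : Fact p.Prime]

/-- **The ONE-FACTOR scaling family** `oneFam u`: on the packet at `(j, v_ℚ)`, factor `0` of `⨂_{i ≤ j}` is multiplied by the scalar `u ∈ ℚˣ` and
the other factors are fixed — «independent copies of Ism on each direct summand of each factor» with Ism the full scalar group. MODEL DATA of a toy.
[claim: Mochizuki2012, status: disputed] -/
def oneFam (u : ℚˣ) : (scalingShells p).PacketAut := fun j vQ =>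
  (scalingShells p).factorwise j vQ fun i => (scalingShells p).summandwise vQ fun _ =>
    if i = (0 : toyIndex.Caps j) then mulEquiv (u : ℚ) u.ne_zero else LinearEquiv.refl ℚ ℚ

omit hp in
/-- `oneFam u` is an (Ind2)-family of the scaling shells. [folklore] -/
theorem oneFam_mem_Ind2Family (u : ℚˣ) : oneFam p u ∈ (scalingShells p).Ind2Family := fun j vQ =>
  ⟨fun i _ => if i = (0 : toyIndex.Caps j) then mulEquiv (u : ℚ) u.ne_zero else LinearEquiv.refl ℚ ℚ,
    fun i v => by
      by_cases h : i = 0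
      · simp only [h, if_true]; exact mulEquiv_mem_scalarAuts ⊤ (Subgroup.mem_top u)
      · simp only [h, if_false]; exact refl_mem_scalarAuts ⊤,
    rfl⟩

omit hp in
/-- … hence an element of the indeterminacy group of every situation over the scaling shells. [folklore] -/
theorem oneFam_mem_indGroup (u : ℚˣ) : oneFam p u ∈ Setting.indGroup (sSituation p) :=
  Subgroup.subset_closure (Set.mem_union_right _ (oneFam_mem_Ind2Family p u))

variable (j : toyIndex.Label) (vQ : toyIndex.VQ)

omit hp in
/-- On the packet line `oneFam u` is the scalar `u` (multilinearity: one factor rescaled). [folklore] -/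
theorem line_oneFam (u : ℚˣ) (x : (scalingShells p).Packet j vQ) : line j vQ (oneFam p u j vQ x) = (u : ℚ) * line j vQ x := by
  have key := line_factorwise_of_smul j vQ
    (fun i => (scalingShells p).summandwise vQ fun _ => if i = (0 : toyIndex.Caps j) then mulEquiv (u : ℚ) u.ne_zero else LinearEquiv.refl ℚ ℚ)
    (fun i => if i = (0 : toyIndex.Caps j) then (u : ℚ) else 1)
    (fun i y => by
      haveI := toyFibreUnique vQ
      funext v
      by_cases h : i = 0
      · simp only [h, if_true]
        rfl
      · simp only [h, if_false]
        show (y v) = ((1 : ℚ) • y) v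
        rw [one_smul])
    x
  have hprod : (∏ i : toyIndex.Caps j, (if i = (0 : toyIndex.Caps j) then (u : ℚ) else 1)) = (u : ℚ) := by
    rw [Finset.prod_ite_eq']; simp
  rw [hprod] at key
  exact key

/-- The `n`-th power of `oneFam u` carries `B_k` onto `B_{k + n·v_p(u)}` (`CandJoshi3.image_pBall_of_scalar_pow`). [folklore] -/
theorem image_oneFam_pow_sBall (u : ℚˣ) (k : ℤ) (n : ℕ) :
    (oneFam p u ^ n) j vQ '' sBall p ⊤ j vQ k = sBall p ⊤ j vQ (k + n * padicValRat p (u : ℚ)) :=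
  image_pBall_of_scalar_pow p (Φ₀ := oneFam p u j vQ) u.ne_zero (line_oneFam p j vQ u) k n

/-- `v_p(p) = 1` and `v_p(p⁻¹) = −1` for the two unit scalars used below. [folklore] -/
theorem padicValRat_pUnit_inv : padicValRat p (((pUnit p)⁻¹ : ℚˣ) : ℚ) = -1 := by
  rw [Units.val_inv_eq_inv_val, padicValRat.inv, padicValRat_pUnit]

variable {j}

/-- **Every ball is a possible image of the Θ-pilot at a label of `𝔽_l^⋇`** over rp-s2's pinned scaling setting: `B_k = oneFam(p^{∓1})^{|k − j²|} (B_{j²})`.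
[folklore] -/
theorem sBall_mem_possibleImages (hj : j ≠ 0) (k : ℤ) : sBall p ⊤ j vQ k ∈ (sSetting p).possibleImages j vQ := by
  have hθ : (sSetting p).thetaRegion3 j vQ = sBall p ⊤ j vQ (jsq j) := by rw [sSetting_thetaRegion3, if_neg hj]
  rcases le_total (jsq j) k with hk | hk
  · -- shrink: u = p, n = k - j²
    refine ⟨oneFam p (pUnit p) ^ (k - jsq j).toNat, Subgroup.pow_mem _ (oneFam_mem_indGroup p (pUnit p)) _, ?_⟩
    rw [hθ, image_oneFam_pow_sBall, padicValRat_pUnit, Int.toNat_of_nonneg (by omega)]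
    congr 1; ring
  · -- enlarge: u = p⁻¹, n = j² - k
    refine ⟨oneFam p (pUnit p)⁻¹ ^ (jsq j - k).toNat, Subgroup.pow_mem _ (oneFam_mem_indGroup p (pUnit p)⁻¹) _, ?_⟩
    rw [hθ, image_oneFam_pow_sBall, padicValRat_pUnit_inv, Int.toNat_of_nonneg (by omega)]
    congr 1; ring

/-- READING R3 at SCAL, directly: the q-region (`B_1`, resp. `{0}` at label `0`) is a possible image in every packet. [folklore] -/
theorem scal_reading3 (j : toyIndex.Label) (vQ : toyIndex.VQ) : (sSetting p).qRegion j vQ ∈ (sSetting p).possibleImages j vQ := by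
  by_cases hj : j = 0
  · subst hj
    rw [sSetting_qRegion, if_pos rfl, ← show (sSetting p).thetaRegion3 0 vQ = {0} by rw [sSetting_thetaRegion3, if_pos rfl]]
    exact (sSetting p).thetaRegion3_mem_possibleImages 0 vQ
  · rw [sSetting_qRegion, if_neg hj]
    exact sBall_mem_possibleImages p vQ hj 1

end Family

/-! ## 3. The cells at SCAL -/

section Cells

variable (p : ℕ) [hp : Fact p.Prime]

/-- **SCAL, RP-J01a: H_J1 HOLDS** (the residual holds there — rp-s2's `door_b_S` — and KummerB + the equivariance of `rho` give H_J1). [folklore] -/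
theorem scal_joshiDominance : JoshiDominance (sLattice p) (sSetting p) (rho p) (qK p) :=
  joshiDominance_of_pilotKummerIndRelated _ _ _ _ (door_b_kummerB p _) (door_b_thetaPinned p).1 (door_b_S p)

/-- **SCAL, RP-J01b: H_J2 HOLDS** (R3 holds there). [folklore] -/
theorem scal_joshiVolumeDominance : JoshiVolumeDominance (sSetting p) :=
  joshiVolumeDominance_of_reading3 _ fun i vQ => scal_reading3 p (Setting.labelSucc i) vQ

/-- **SCAL, RP-J01c: H_J2ᵖˡ HOLDS.** [folklore] -/
theorem scal_placeDominance : JoshiPlaceDominance (sSetting p) :=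
  placeDominance_of_joshiVolumeDominance _ (scal_joshiVolumeDominance p)

/-- **SCAL, RP-J02a: H_J3 HOLDS** (R3 under the q-pin). [folklore] -/
theorem scal_locusCovers : LocusCovers (sLattice p) (sSetting p) (rho p) (qK p) :=
  locusCovers_of_reading3 _ _ _ _ (door_b_qPinned p) (scal_reading3 p)

/-- **SCAL, RP-J02b: H_J3′ (the Θ-side FILLING) HOLDS** — every hull-set (a ball on `𝔽_l^⋇`, the point `{0}` at label `0`) is a possible image of the
Θ-pilot, because the scaling indeterminacies reach every ball; the containment hypotheses of `ShellFilling` are not even needed. The first non-degenerate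
model of record for Joshi's filling claim (ATS II Thm. 7.8.1 / §9). [claim: Joshi2021ATSII, status: disputed] -/
theorem scal_shellFilling : ShellFilling (sLattice p) (sSetting p) (rho p) := by
  intro j vQ H' hH' _ _
  have hfr : (sSetting p).frame j vQ = (if j = 0 then zeroFrame p j vQ else sFrame p ⊤ j vQ) := rfl
  by_cases hj : j = 0
  · subst hj
    rw [hfr, if_pos rfl] at hH'
    rw [Set.mem_singleton_iff.1 hH', ← show (sSetting p).thetaRegion3 0 vQ = {0} by rw [sSetting_thetaRegion3, if_pos rfl]]
    exact (sSetting p).thetaRegion3_mem_possibleImages 0 vQ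
  · rw [hfr, if_neg hj] at hH'
    obtain ⟨k, rfl⟩ := hH'
    exact sBall_mem_possibleImages p vQ hj k

/-- **THE PRICE at SCAL** (this seat's `CandJoshi3.not_statement_of_unbounded_orbit`, instantiated by `oneFam p⁻¹` at label `1`): `−|log(Θ)| = +∞`,
the typed Statement FAILS (first clause), the bridge hypotheses of record FAIL. (rp-s2's part (b) `ObstructionSS12` records the same price with the
honest-packet and Haar clauses; this is the B3-side derivation.) [folklore] -/
theorem scal_price : (sSetting p).negLogTheta = ⊤ ∧ ¬ (sSetting p).Statement ∧ ¬ BridgeHyps (sSetting p) := by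
  have h1 : (Setting.labelSucc (⟨0, by decide⟩ : Fin toyIndex.lstar) : toyIndex.Label) ≠ 0 := Setting.labelSucc_ne_zero _
  refine not_statement_of_unbounded_orbit (sSetting p) (oneFam_mem_indGroup p (pUnit p)⁻¹) (i := ⟨0, by decide⟩) (vQ := ()) ?_
  have hfr : (sSetting p).frame (Setting.labelSucc (⟨0, by decide⟩ : Fin toyIndex.lstar)) () =
      pFrame p (Setting.labelSucc (⟨0, by decide⟩ : Fin toyIndex.lstar)) () := by
    show (if Setting.labelSucc (⟨0, by decide⟩ : Fin toyIndex.lstar) = (0 : toyIndex.Label) then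
        zeroFrame p (Setting.labelSucc (⟨0, by decide⟩ : Fin toyIndex.lstar)) ()
      else sFrame p ⊤ (Setting.labelSucc (⟨0, by decide⟩ : Fin toyIndex.lstar)) ()) = _
    rw [if_neg h1]; rfl
  have hθ : (sSetting p).thetaRegion3 (Setting.labelSucc (⟨0, by decide⟩ : Fin toyIndex.lstar)) () =
      pBall p (Setting.labelSucc (⟨0, by decide⟩ : Fin toyIndex.lstar)) () (jsq (Setting.labelSucc (⟨0, by decide⟩ : Fin toyIndex.lstar))) := by
    rw [sSetting_thetaRegion3, if_neg h1]; rfl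
  rw [hfr, hθ]
  refine not_isBounded_orbit_of_dominates p (oneFam p (pUnit p)⁻¹ (Setting.labelSucc (⟨0, by decide⟩ : Fin toyIndex.lstar)) ())
    (k := jsq (Setting.labelSucc (⟨0, by decide⟩ : Fin toyIndex.lstar)))
    (k' := jsq (Setting.labelSucc (⟨0, by decide⟩ : Fin toyIndex.lstar)) - 1) (Set.Subset.antisymm_iff.1 ?_).2 (by omega)
  have himg := image_oneFam_pow_sBall p (Setting.labelSucc (⟨0, by decide⟩ : Fin toyIndex.lstar)) () (pUnit p)⁻¹
    (jsq (Setting.labelSucc (⟨0, by decide⟩ : Fin toyIndex.lstar))) 1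
  rw [pow_one, padicValRat_pUnit_inv, Nat.cast_one, one_mul] at himg
  refine himg.trans ?_
  show pBall p _ () _ = pBall p _ () _
  congr 1

/-- **SCAL cells, packaged**: two pins ∧ KummerB ∧ the residual `S` ∧ **all five Joshi-shaped candidates** ∧ `−|log(Θ)| = +∞` ∧ ¬Statement ∧ ¬BridgeHyps.
[folklore] -/
theorem scal_cells :
    PinnedRegions (sLattice p) (sSetting p) (rho p) (qK p) ∧ ((sLattice p).col (sSetting p).n).KummerB ((sLattice p).D (sSetting p).n) ∧
      PilotKummerIndRelated (sLattice p) (sSetting p) (rho p) (qK p) ∧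
      JoshiDominance (sLattice p) (sSetting p) (rho p) (qK p) ∧ JoshiVolumeDominance (sSetting p) ∧ JoshiPlaceDominance (sSetting p) ∧
      LocusCovers (sLattice p) (sSetting p) (rho p) (qK p) ∧ ShellFilling (sLattice p) (sSetting p) (rho p) ∧
      (sSetting p).negLogTheta = ⊤ ∧ ¬ (sSetting p).Statement ∧ ¬ BridgeHyps (sSetting p) :=
  ⟨door_b_pinnedRegions p, door_b_kummerB p _, door_b_S p, scal_joshiDominance p, scal_joshiVolumeDominance p, scal_placeDominance p,
    scal_locusCovers p, scal_shellFilling p, scal_price p⟩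

end Cells

end Summit.ABC.IUTFork.Repair.CandJoshi1BedScal

end
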